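import Summits.AtomisticToContinuum.Crystallization.Theorems.FluxTubeKeplerFloorGivesLayered
import Summits.AtomisticToContinuum.Crystallization.Theorems.FluxTubeKeplerFluxCellKeplerSingleScale
import Summits.AtomisticToContinuum.Crystallization.Theorems.ChessboardParticlePlanesPeriodicWindowsIffCrystallization
import Summits.AtomisticToContinuum.Crystallization.Theorems.FluxTubeKeplerKeplerEnergyFloor

/-!
# Line `HardCoreRung` (hard-core ladder) — skeleton for the forward rung over `FluxTubeKepler.FloorGivesLayered`
(crux dir `FluxCellKepler`, stmt-AtomisticToContinuum-15221; fwd-rung G1 gen 11, seed g1-AtomisticToContinuum-15223)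

FLOOR (proved, `FluxTubeKeplerFloorGivesLayered.FloorGivesLayered_proof`): for every periodic `P₀`, the energy
floor `N·e(P₀) ≤ E(x)` on Lennard-Jones ground states together with the defect BUDGET
`c(R,η) · #{(R,η)-non-layered sites of x} ≤ E(x) − N·e(P₀)`, demanded of EVERY Lennard-Jones ground state `x`
of every size, forces layered windows — hence (proved `PeriodicGivenLayered`) periodic windows — along every
ground-state sequence.  Its proof is potential-blind counting (`E(N) − N·e⋆ = o(N)` leaves one un-priced site per
scale) + compactness of the spacing + dilation covariance; it never looks at a pair distance.

THE GRADED FAMILY `SepRung δ₀` (ONE move — one hypothesis generalised by one real parameter: the budget is demanded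
only of ground states whose points are pairwise `≥ δ₀` apart, i.e. of the HARD-CORE class `δ₀`):
* `SepRung 0` is the floor (`sepRung_zero`: the separation premise `0 ≤ dist` is vacuous; the seed +
  `PeriodicGivenLayered_holds`);
* the dial is MONOTONE (`sepRung_anti`: a larger hard core is a weaker hypothesis, so the rung with the larger
  `δ₀` is the stronger statement), and `SepRung δ₀` for `δ₀ ≤ 7/10` is floor-regime: the tree's minimal-distance
  theorem `LjLaminarWindowsSketch.stub_minDistance07` (every LJ ground state is `7/10`-separated; Yuhjtman 2015
  Cor. 7 gives `0.684`) makes the hard-core premise automatic (`sepRung_of_minDist`; certificate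
  `Lines/HardCoreRung_special.lean: sepRung_seven_tenths`);
* every member is a consequence of the sub-problem (`sepRung_of_crystallization`, on path, via the landed
  `periodicWindows_of_crystallization`);
* deciding rung `HardCoreRung := SepRung (3/4)` — "a Kepler budget certified only on the hard-core class `3/4`
  still forces crystallization of the ground states".  The floor's Step 1 (`eventually_exists_not_bad`) stops:
  under `SepBudget (3/4)` the inequality is available for the ground state `x N` only if `x N` is
  `3/4`-separated, and nothing in the floor's proof (nor in the tree: `7/10`) supplies that.  The new input is a
  HARD CORE `3/4` for Lennard-Jones ground states (`MinDist (3/4)`), beyond the reach of the landed closest-pair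
  method (removal inequality + force balance + Yuhjtman capacity closes only up to `a ≈ 0.715`): Stub 1 excludes a
  LONE compressed bond by force balance against far neighbours only (the landed machinery, new constants), Stub 2
  — the bet — excludes a CAGED compressed bond (a second neighbour within `19/20`) by one-particle relocation /
  cluster dilation, a finite local certificate over `7/10`-separated neighbourhoods.
* RELIEF for the parent crux (sorry-free, § Relief): with `MinDist δ₀` the crux `FluxCellKepler` may be replaced by
  `FluxCellKeplerAt δ₀` — KEPLER certified at the single hard core `δ₀` instead of `∀ δ > 0`
  (`crystallization_of_minDist_of_fluxCellKeplerAt`); at `δ₀ = 3/4` the flux-cell patterns are `3/4`-separated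
  finite sets, the regime in which cell-by-cell coercivity is a finite computation.
* CEILING of the ladder: `SepRung δ₀` is provable by hard-core theorems only for `δ₀ < d_∞ := liminf_N (minimal
  pair distance of N-particle ground states) ≤ a⋆ ≈ 0.971` (bulk nearest-neighbour distance of LJ-fcc/hcp;
  icosahedral cores are compressed further); for `δ₀ > d_∞` the hard-core budget is vacuous on large ground states
  and `SepRung δ₀` collapses to "attainment ⇒ crystallization" (summit strength).  The ladder is capped strictly
  below the summit; what lies between its top and `Crystallization` is exactly KEPLER at hard core `d_∞`, i.e. the
  parent crux restricted (`FluxCellKeplerAt`).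

Stubs (the only `sorry`s): `stub_loneBond`, `stub_cagedBond`; composition `HardCoreRung_of` is sorry-free.
-/

noncomputable section

namespace Summit.AtomisticToContinuum.Crystallization.Cruxes.FluxCellKepler.HardCoreLadder

open Filter Topology
open scoped BigOperators
open Literature.MathematicalPhysics.StatisticalMechanics
open Summit.AtomisticToContinuum.Crystallization.Theorems.FluxCellKeplerSingleScale (LayeredGood)

local notation "E3" => EuclideanSpace ℝ (Fin 3)

/-- FLOOR(P₀): `N · e(P₀) ≤ E(x)` for every Lennard-Jones ground state `x` of every size `N`
(verbatim the first hypothesis of `FluxTubeKepler.FloorGivesLayered`). -/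
def Floor (P₀ : PeriodicConfiguration 3) : Prop :=
  ∀ (N : ℕ) (x : Fin N → E3), IsGroundState lennardJones x →
    (N : ℝ) * P₀.energyPerParticle lennardJones ≤ interactionEnergy lennardJones x

/-- HARD-CORE BUDGET with core `δ₀`: for every radius `R > 0` and tolerance `η > 0` some `c > 0` prices the
`(R,η)`-non-layered sites against the excess energy over `N · e(P₀)` — but only on those Lennard-Jones ground
states whose points are pairwise at distance `≥ δ₀` (`δ₀ = 0`: the floor's budget verbatim, `LayeredGood` = the
crux's defect predicate, quantifier order `∀ R η ∃ c` of the crux kept; the separation premise is the one KEPLER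
of `FluxCellKepler` carries). -/
def SepBudget (δ₀ : ℝ) (P₀ : PeriodicConfiguration 3) : Prop :=
  ∀ R η : ℝ, 0 < R → 0 < η → ∃ c : ℝ, 0 < c ∧
    ∀ (N : ℕ) (x : Fin N → E3), IsGroundState lennardJones x →
      (∀ i j : Fin N, i ≠ j → δ₀ ≤ dist (x i) (x j)) →
      c * (Nat.card {i : Fin N // ¬ LayeredGood R η x i} : ℝ) ≤
        interactionEnergy lennardJones x - (N : ℝ) * P₀.energyPerParticle lennardJones

/-- Periodic windows at every scale along the sequence `x` (ONE periodic `P`, translations only) —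
verbatim the conclusion of `FluxTubeKepler.PeriodicWindows` / `FluxTubeKepler.PeriodicGivenLayered`. -/
def HasPeriodicWindows (x : (N : ℕ) → (Fin N → E3)) : Prop :=
  ∃ P : PeriodicConfiguration 3, ∀ R ε : ℝ, 0 < ε → ∃ᶠ N in atTop, ∃ t : E3,
    (∀ q ∈ P.points, ‖q‖ ≤ R → ∃ i : Fin N, dist (x N i + t) q ≤ ε) ∧
    (∀ i : Fin N, ‖x N i + t‖ ≤ R → ∃ q ∈ P.points, dist (x N i + t) q ≤ ε)

/-- **The graded family.** `SepRung δ₀`: FLOOR and the hard-core budget with core `δ₀` force periodic windows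
along every Lennard-Jones ground-state sequence. -/
def SepRung (δ₀ : ℝ) : Prop :=
  ∀ P₀ : PeriodicConfiguration 3, Floor P₀ → SepBudget δ₀ P₀ →
    ∀ x : (N : ℕ) → (Fin N → E3), (∀ N, IsGroundState lennardJones (x N)) → HasPeriodicWindows x

/-- **Deciding rung.** The hard core `3/4` — the next value after the tree's `7/10`. -/
def HardCoreRung : Prop := SepRung (3 / 4)

/-- The pointwise HARD CORE `δ₀` of Lennard-Jones ground states (all sizes): every two particles of every
ground state are at distance `≥ δ₀`.  In the tree for `δ₀ = 1/3` (`LennardJonesMinimalDistance_holds`),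
`0.684` (`Yuhjtman2015_minDistance_holds`) and `7/10` (`LjLaminarWindowsSketch.stub_minDistance07`). -/
def MinDist (δ₀ : ℝ) : Prop :=
  ∀ (N : ℕ) (x : Fin N → E3), IsGroundState lennardJones x → ∀ i j : Fin N, i ≠ j → δ₀ ≤ dist (x i) (x j)

/-! ## F3 — the family specialises to the proved floor -/

/-- At core `0` the hard-core budget IS the floor's budget (the premise `0 ≤ dist` is automatic). -/
theorem sepBudget_zero_iff (P₀ : PeriodicConfiguration 3) :
    SepBudget 0 P₀ ↔
      ∀ R η : ℝ, 0 < R → 0 < η → ∃ c : ℝ, 0 < c ∧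
        ∀ (N : ℕ) (x : Fin N → E3), IsGroundState lennardJones x →
          c * (Nat.card {i : Fin N // ¬ LayeredGood R η x i} : ℝ) ≤
            interactionEnergy lennardJones x - (N : ℝ) * P₀.energyPerParticle lennardJones := by
  refine forall₄_congr fun R η _ _ => exists_congr fun c => and_congr_right fun _ =>
    forall₃_congr fun N x _ => ?_
  exact ⟨fun h => h fun i j _ => dist_nonneg, fun h _ => h⟩

/-- `SepRung 0` is the floor: the seed theorem followed by the proved `PeriodicGivenLayered`. -/
theorem sepRung_zero : SepRung 0 := fun P₀ hF hB x hx =>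
  Theses.FluxTubeKepler.PeriodicGivenLayered_holds x hx
    (Theorems.FluxTubeKeplerFloorGivesLayered.FloorGivesLayered_proof P₀ hF
      ((sepBudget_zero_iff P₀).1 hB) x hx)

/-! ## Dial monotonicity (harder-to-easier = decreasing core) -/

/-- A larger hard core is a weaker budget hypothesis. -/
theorem sepBudget_mono {δ₀ δ₁ : ℝ} (h : δ₀ ≤ δ₁) {P₀ : PeriodicConfiguration 3} :
    SepBudget δ₀ P₀ → SepBudget δ₁ P₀ := by
  intro hB R η hR hη
  obtain ⟨c, hc, hcN⟩ := hB R η hR hη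
  exact ⟨c, hc, fun N x hx hsep => hcN N x hx fun i j hij => h.trans (hsep i j hij)⟩

/-- `SepRung` is monotone in the core: the rung with the larger core implies the one with the smaller. -/
theorem sepRung_anti {δ₀ δ₁ : ℝ} (h : δ₀ ≤ δ₁) : SepRung δ₁ → SepRung δ₀ :=
  fun H P₀ hF hB x hx => H P₀ hF (sepBudget_mono h hB) x hx

/-- The deciding rung gives back the floor member (informational `specialises`). -/
theorem sepRung_zero_of_hardCoreRung (h : HardCoreRung) : SepRung 0 :=
  sepRung_anti (by norm_num) h

/-- **Transfer.** A hard core `δ₀` for ground states makes the hard-core premise automatic: `MinDist δ₀ → SepRung δ₀`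
(the floor, verbatim, on the budget restored to all ground states).  This is how the dial is climbed. -/
theorem sepRung_of_minDist {δ₀ : ℝ} (hmd : MinDist δ₀) : SepRung δ₀ := fun P₀ hF hB x hx =>
  sepRung_zero P₀ hF ((sepBudget_zero_iff P₀).2 fun R η hR hη => by
    obtain ⟨c, hc, h⟩ := hB R η hR hη
    exact ⟨c, hc, fun N y hy => h N y hy (hmd N y hy)⟩) x hx

/-! ## F4 — on-path lemmas: the sub-problem implies every member -/

/-- ON-PATH: `Crystallization → SepRung δ₀` for every core (landed hull-criterion converse
`periodicWindows_of_crystallization`). -/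
theorem sepRung_of_crystallization (δ₀ : ℝ) (h : _root_.Crystallization) : SepRung δ₀ :=
  fun _ _ _ x hx =>
    Theorems.ChessboardParticlePlanesPeriodicWindowsIffCrystallization.periodicWindows_of_crystallization h x hx

/-- ON-PATH for the deciding rung (tagged `aesop safe apply` so that the tribunal's fixed `S → C` portfolio finds
it). -/
@[aesop safe apply]
theorem HardCoreRung_of_Crystallization (h : _root_.Crystallization) : HardCoreRung :=
  sepRung_of_crystallization _ h

/-! ## Relief — how the rung relaxes the parent crux `FluxCellKepler` (documentation, sorry-free)

`FluxCellKeplerAt δ₀` is the parent crux with KEPLER demanded at the SINGLE hard core `δ₀` (the crux asks it for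
every `δ > 0`).  With a hard core `δ₀` for ground states, `FluxCellKeplerAt δ₀` already decides the sub-problem. -/

/-- The floor-and-hard-core-budget package (what DOM + KEPLER-at-`δ₀` deliver on ground states). -/
def SepKeplerFloor (δ₀ : ℝ) : Prop := ∃ P₀ : PeriodicConfiguration 3, Floor P₀ ∧ SepBudget δ₀ P₀

/-- The parent crux with KEPLER at the single hard core `δ₀` (DOM verbatim; the defect predicate is the crux's,
written `LayeredGood`). -/
def FluxCellKeplerAt (δ₀ : ℝ) : Prop :=
  ∃ (P₀ : PeriodicConfiguration 3) (R₁ : ℝ) (τ : Finset E3 → ℝ),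
    (∀ (N : ℕ) (x : Fin N → E3), Function.Injective x →
      ∑ i, siteEnergy (fun r => (r⁻¹) ^ 6) x i ≤
        ∑ i, τ ((Finset.univ.filter fun j : Fin N => dist (x j) (x i) ≤ R₁).image fun j => x j - x i)) ∧
    (∀ R η : ℝ, 0 < R → 0 < η → ∃ c : ℝ, 0 < c ∧ ∀ (N : ℕ) (x : Fin N → E3), Function.Injective x →
      (∀ i j, i ≠ j → δ₀ ≤ dist (x i) (x j)) →
      c * (Nat.card {i : Fin N // ¬ LayeredGood R η x i} : ℝ) ≤
        ∑ i, ((1 / 24 : ℝ) * siteEnergy (fun r => (r⁻¹) ^ 12) x i -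
          (1 / 12 : ℝ) * τ ((Finset.univ.filter fun j : Fin N => dist (x j) (x i) ≤ R₁).image fun j => x j - x i)) -
        (N : ℝ) * P₀.energyPerParticle lennardJones)

/-- The crux as filed gives the single-core version at every `δ₀ > 0`. -/
theorem fluxCellKeplerAt_of_fluxCellKepler {δ₀ : ℝ} (hδ : 0 < δ₀) (hK : Theses.FluxTubeKepler.FluxCellKepler) :
    FluxCellKeplerAt δ₀ := by
  obtain ⟨P₀, R₁, τ, hDOM, hKEP⟩ := hK
  exact ⟨P₀, R₁, τ, hDOM, fun R η hR hη => hKEP δ₀ hδ R η hR hη⟩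

/-- DOM + KEPLER-at-`δ₀` + hard core `δ₀` for ground states ⇒ the floor-and-hard-core-budget package (the bookkeeping
of the proved `keplerEnergyFloor_proof`, at the single core). -/
theorem sepKeplerFloor_of_fluxCellKeplerAt {δ₀ : ℝ} (hK : FluxCellKeplerAt δ₀) (hmd : MinDist δ₀) :
    SepKeplerFloor δ₀ := by
  obtain ⟨P₀, R₁, τ, hDOM, hKEP⟩ := hK
  refine ⟨P₀, ?_, ?_⟩
  · intro N x hx
    obtain ⟨c, hc, h⟩ := hKEP 1 1 one_pos one_pos
    have h1 := Theorems.keplerEnergyFloor_floor_of_dom_kepler' _ _ _ _ _ _ (hDOM N x hx.1)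
      (h N x hx.1 (hmd N x hx)) hc (by positivity)
    rw [← Theorems.FluxCellKeplerSketch.interactionEnergy_lennardJones_eq_sum] at h1
    exact h1
  · intro R η hR hη
    obtain ⟨c, hc, h⟩ := hKEP R η hR hη
    refine ⟨c, hc, fun N x hx hsep => ?_⟩
    have h1 := Theorems.keplerEnergyFloor_floor_of_dom_kepler _ _ _ _ _ _ (hDOM N x hx.1) (h N x hx.1 hsep)
    rw [← Theorems.FluxCellKeplerSketch.interactionEnergy_lennardJones_eq_sum] at h1
    linarith

/-- The rung closes the sub-problem from the package. -/
theorem crystallization_of_sepRung {δ₀ : ℝ} (h : SepRung δ₀) (hK : SepKeplerFloor δ₀) :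
    _root_.Crystallization := by
  obtain ⟨P₀, hF, hB⟩ := hK
  exact Theorems.ChessboardParticlePlanesPeriodicWindowsIffCrystallization.crystallization_of_periodicWindows
    (fun x hx => h P₀ hF hB x hx)

/-- **Relief, assembled.** A hard core `δ₀` for ground states lets the route replace `FluxCellKepler` by
`FluxCellKeplerAt δ₀`: `MinDist δ₀ → FluxCellKeplerAt δ₀ → Crystallization`. -/
theorem crystallization_of_minDist_of_fluxCellKeplerAt {δ₀ : ℝ} (hmd : MinDist δ₀) (hK : FluxCellKeplerAt δ₀) :
    _root_.Crystallization :=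
  crystallization_of_sepRung (sepRung_of_minDist hmd) (sepKeplerFloor_of_fluxCellKeplerAt hK hmd)

/-! ## The line: a hard core `3/4` for Lennard-Jones ground states, by a case split at the closest pair

At a ground state `x` let `(p, q)` be a CLOSEST pair, `a = dist (x p) (x q)`.  The tree knows `a ≥ 7/10`
(`stub_minDistance07`: removal inequality `∑_{k ≠ p} V(r_{pk}) ≤ 0`, force balance `∇_p E = 0` projected on
`pq`, Yuhjtman capacity).  Two declared stubs. -/

/-- **Stub 1 — NO LONE COMPRESSED BOND (force balance against far neighbours; M).**  If the closest pair has
`a < 3/4` then `p` has a SECOND neighbour within `19/20`: otherwise the repulsion `|V'(a)| ≥ |V'(3/4)| ≈ 34.6`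
along `pq` must be balanced by particles all at distance `> 19/20` from `p`, pairwise `≥ a ≥ 7/10` apart, whose
total force on `p` is at most `∑ |V'(r_{pk})|` ≤ (capacity of a `7/10`-separated family outside radius `19/20`:
`|V'| ≤ 0.52` on `[19/20, 1]`, `≤ 0.225` beyond) — the landed `stub_forceBalance` / `stub_forceCapacity`
machinery with the near shell `[a, 19/20]` emptied. [folklore; Yuhjtman2015] -/
theorem stub_loneBond :
    ∀ (N : ℕ) (x : Fin N → E3), IsGroundState lennardJones x → ∀ p q : Fin N, p ≠ q →
      (∀ k l : Fin N, k ≠ l → dist (x p) (x q) ≤ dist (x k) (x l)) →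
      dist (x p) (x q) < 3 / 4 →
      ∃ k : Fin N, k ≠ p ∧ k ≠ q ∧ dist (x p) (x k) ≤ 19 / 20 := by
  sorry

/-- **Stub 2 — NO CAGED COMPRESSED BOND (relocation; L — the bet).**  If `(p, q)` is a closest pair and `p` has a
second neighbour within `19/20`, then `a ≥ 3/4`: a compressed bond inside a cage is removed by RELOCATING `p`
(or dilating the compressed cluster about its barycentre) at an energy gain `≥ V(a) − V(1) − (Lipschitz cost of
the other bonds of p)`, positive for `a < 3/4`; the admissible local configurations (neighbours of `p` within
radius `2`, pairwise `≥ 7/10` apart by the tree's hard core) form a compact finite-dimensional family on which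
"some single-particle move lowers the energy" is a finite certificate (interval branch-and-bound) — the new,
many-body ingredient absent from removal + force balance, whose reach ends at `a ≈ 0.715`. [conjecture] -/
theorem stub_cagedBond :
    ∀ (N : ℕ) (x : Fin N → E3), IsGroundState lennardJones x → ∀ p q : Fin N, p ≠ q →
      (∀ k l : Fin N, k ≠ l → dist (x p) (x q) ≤ dist (x k) (x l)) →
      (∃ k : Fin N, k ≠ p ∧ k ≠ q ∧ dist (x p) (x k) ≤ 19 / 20) →
      3 / 4 ≤ dist (x p) (x q) := by
  sorry

/-! ### The stub statements as named propositions (verbatim) -/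

/-- Statement of `stub_loneBond` (verbatim). [folklore] -/
def Sig.stub_loneBond : Prop :=
    ∀ (N : ℕ) (x : Fin N → E3), IsGroundState lennardJones x → ∀ p q : Fin N, p ≠ q →
      (∀ k l : Fin N, k ≠ l → dist (x p) (x q) ≤ dist (x k) (x l)) →
      dist (x p) (x q) < 3 / 4 →
      ∃ k : Fin N, k ≠ p ∧ k ≠ q ∧ dist (x p) (x k) ≤ 19 / 20

/-- Statement of `stub_cagedBond` (verbatim). [conjecture] -/
def Sig.stub_cagedBond : Prop :=
    ∀ (N : ℕ) (x : Fin N → E3), IsGroundState lennardJones x → ∀ p q : Fin N, p ≠ q →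
      (∀ k l : Fin N, k ≠ l → dist (x p) (x q) ≤ dist (x k) (x l)) →
      (∃ k : Fin N, k ≠ p ∧ k ≠ q ∧ dist (x p) (x k) ≤ 19 / 20) →
      3 / 4 ≤ dist (x p) (x q)

/-! ### The skeleton theorems: the hard core and the rung BY NAME from the two stub statements (sorry-free) -/

/-- **Hard core `3/4`.** `stub_loneBond → stub_cagedBond → MinDist (3/4)`: at a closest pair `(p,q)` with `a < 3/4`
Stub 1 produces a second neighbour of `p` within `19/20` and Stub 2 then forces `a ≥ 3/4` — contradiction; every
other pair is at least as far apart as the closest one. -/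
theorem minDist_of (h₁ : Sig.stub_loneBond) (h₂ : Sig.stub_cagedBond) : MinDist (3 / 4) := by
  intro N x hx i j hij
  obtain ⟨pr, hpr, hmin⟩ := Finset.exists_min_image Finset.univ.offDiag
    (fun pr : Fin N × Fin N => dist (x pr.1) (x pr.2)) ⟨(i, j), by simp [hij]⟩
  obtain ⟨p, q⟩ := pr
  have hpq : p ≠ q := by simpa using hpr
  have hle : ∀ k l : Fin N, k ≠ l → dist (x p) (x q) ≤ dist (x k) (x l) :=
    fun k l hkl => hmin (k, l) (by simp [hkl])
  have h34 : (3 : ℝ) / 4 ≤ dist (x p) (x q) := by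
    by_contra hlt
    rw [not_le] at hlt
    exact absurd (h₂ N x hx p q hpq hle (h₁ N x hx p q hpq hle hlt)) (not_le.2 hlt)
  exact h34.trans (hle i j hij)

/-- **Assembly.** `stub_loneBond → stub_cagedBond → HardCoreRung`: the hard core `3/4` (above) makes the hard-core
premise of `SepBudget (3/4)` automatic on ground states, and the floor (seed + `PeriodicGivenLayered`) concludes. -/
theorem HardCoreRung_of (h₁ : Sig.stub_loneBond) (h₂ : Sig.stub_cagedBond) : HardCoreRung :=
  sepRung_of_minDist (minDist_of h₁ h₂)

/-- **The closed skeleton instance**: the rung by name from the two declared stubs (the only `sorry`s of this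
file enter here). [conjecture] -/
theorem HardCoreRung_skeleton : HardCoreRung :=
  HardCoreRung_of stub_loneBond stub_cagedBond

end Summit.AtomisticToContinuum.Crystallization.Cruxes.FluxCellKepler.HardCoreLadder

end
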